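import Summits.HubbardSuperconductivity.HubbardSuperconductivity.Theorems.BalabanIRBirEveryGroundStateSocket
import Summits.HubbardSuperconductivity.HubbardSuperconductivity.Theorems.BalabanIRBirEveryGroundStateHeadCount

/-!
# Route `BalabanIR`, crux 5 `BirEveryGroundState` (`stmt-HubbardSuperconductivity-2083`):
# the TWO-SCALE DOMINATION inequality (card `two-scale-domination`, first lemma)

Theses-free companion of `BalabanIRBirEveryGroundStateSocket.lean` (rev-5 MATERIALISATION RULE:
this module imports no route file and no Theorems module that does). It proves the lever of the
crux-ideate card `Cruxes/BirEveryGroundState/Ideas/two-scale-domination.md` (ideator 1, gen 2,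
2026-08-16; `Sketch_ideator1g2.lean`), which passes from the ground-state AVERAGE to EVERY ground
state with no structure theory of the ground eigenspace (no Schur, no Kato, no genericity):

* `re_star_dotProduct_conjTranspose_mul_self_mulVec_le` / `domination` — DOMINATION: a unit
  vector `ψ` of a subspace `K` (orthogonal projection `P`, `d = re tr P = dim K`) is dominated by
  the un-normalised trace over `K` on every positive semidefinite observable,
  `re ⟨ψ, X ψ⟩ ≤ re tr (P X) = d · ⟨X⟩_avg` (`P ≥ |ψ⟩⟨ψ|`; here: `‖B ψ‖ = ‖(B P) ψ‖ ≤ ‖B P‖_F`).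
* `sum_sum_conjTranspose_sub_mul_sub` — the BLOCK-DIFFERENCE IDENTITY
  `Σ_{x,x'} (m x - m x')ᴴ (m x - m x') = 2 |ι| Σ_x (m x)ᴴ m x - 2 (Σ m)ᴴ (Σ m)` (polarisation).
* `sq_re_star_dotProduct_mulVec_le_re` — Cauchy–Schwarz `(re ⟨ψ, R ψ⟩)² ≤ re ⟨ψ, Rᴴ R ψ⟩`.
* `twoScaleDomination_sum` / `twoScaleDomination` — the card's inequality (★) (sum form with
  the positivity facts `0 < d`, `0 ≤ V`, `Y ≤ A`; and the MEAN form, in the binder shape of the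
  Sketch's `TwoScaleDomination`): for a finite family of block matrices `m x`, their mean
  `M = |ι|⁻¹ Σ m x`, a unit `ψ ∈ K` and a centre `t`,
  `t - √(d · V(t)) - d · (A - Y) ≤ re ⟨ψ, Mᴴ M ψ⟩`, where (GS-average functionals, traces over
  `K` divided by `d`) `A = |ι|⁻¹ Σ_x ⟨(m x)ᴴ m x⟩_avg` is the block intensity, `Y = ⟨Mᴴ M⟩_avg` the
  global intensity and `V(t) = |ι|⁻¹ Σ_x ⟨((m x)ᴴ m x - t)²⟩_avg` the block variance about `t`.
  Proof = domination twice, Cauchy–Schwarz once, subtract: EVERY vector of `K` carries the average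
  global intensity up to a RIGIDITY error `√(d V)` and a SAG error `d (A - Y)`; `d` is a budget.
* `mul_sq_card_le_re_of_twoScale` — the budgeted form consumed by a transfer:
  `c ≤ Y`, `d ≤ D`, `V(A) ≤ ε₁`, `A - Y ≤ ε₂`, `√(D ε₁) + D ε₂ ≤ c / 2` ⇒
  `(c / 2) |ι|² ≤ re ⟨ψ, Sᴴ S ψ⟩` (`S = Σ m x`), i.e. `c / 2 ≤ re ⟨ψ, Mᴴ M ψ⟩`.
The Hubbard instantiation (blocks = `Λ × Λ` box averages of the local `d`-wave pair operator,
anchor mean `Δ_d / L²`) is in the companion `BalabanIRBirEveryGroundStateTwoScaleTransfer.lean`.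

Bratteli–Robinson I §2.3 (domination of positive functionals); Bhatia, *Matrix Analysis* (1997)
§I.2 (Frobenius vs operator norm); Griffiths, Phys. Rev. 152 (1966) 240 (block vs global order
parameters). Everything is folklore finite-dimensional linear algebra; no definition is introduced.
-/

noncomputable section

namespace Summit.HubbardSuperconductivity.HubbardSuperconductivity.Theorems

open Matrix Finset Filter
open Literature.Probability.LatticeModels Literature.MathematicalPhysics.QuantumLattice
open scoped ComplexOrder

section Domination

variable {n : Type*} [Fintype n]

/-- **Domination, core form.** For a Hermitian idempotent `P`, a vector `ψ` with `P ψ = ψ` and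
`‖ψ‖ = 1`, and any matrix `B`: `re ⟨ψ, Bᴴ B ψ⟩ = ‖B ψ‖² = ‖(B P) ψ‖² ≤ ‖B P‖_F² = re tr (P Bᴴ B)`
(Frobenius bound `re_star_mulVec_dotProduct_mulVec_le`, `P² = P = Pᴴ`, cyclicity).
Bhatia, *Matrix Analysis* §I.2; Bratteli–Robinson I §2.3. [folklore] -/
theorem re_star_dotProduct_conjTranspose_mul_self_mulVec_le {P : Matrix n n ℂ} (hPH : Pᴴ = P)
    (hPP : P * P = P) (B : Matrix n n ℂ) {ψ : n → ℂ} (hPψ : P *ᵥ ψ = ψ)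
    (hψ : star ψ ⬝ᵥ ψ = 1) :
    (star ψ ⬝ᵥ (Bᴴ * B) *ᵥ ψ).re ≤ (P * (Bᴴ * B)).trace.re := by
  have hBP : (B * P) *ᵥ ψ = B *ᵥ ψ := by rw [← mulVec_mulVec, hPψ]
  have h1 : star ψ ⬝ᵥ (Bᴴ * B) *ᵥ ψ = star ((B * P) *ᵥ ψ) ⬝ᵥ ((B * P) *ᵥ ψ) := by
    rw [hBP, star_mulVec, ← dotProduct_mulVec, mulVec_mulVec]
  have h2 := re_star_mulVec_dotProduct_mulVec_le (B * P) ψ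
  rw [hψ, Complex.one_re, mul_one] at h2
  have h3 : ((B * P)ᴴ * (B * P)).trace = (P * (Bᴴ * B)).trace := by
    have e : (B * P)ᴴ * (B * P) = P * (Bᴴ * B) * P := by
      rw [conjTranspose_mul, hPH]; simp only [Matrix.mul_assoc]
    rw [e, trace_mul_cycle, hPP]
  rw [h1, ← h3]
  exact h2

/-- `0 ≤ re ⟨ψ, Bᴴ B ψ⟩ = ‖B ψ‖²`. [folklore] -/
theorem re_star_dotProduct_conjTranspose_mul_self_mulVec_nonneg (B : Matrix n n ℂ) (ψ : n → ℂ) :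
    0 ≤ (star ψ ⬝ᵥ (Bᴴ * B) *ᵥ ψ).re := by
  rw [show star ψ ⬝ᵥ (Bᴴ * B) *ᵥ ψ = star (B *ᵥ ψ) ⬝ᵥ (B *ᵥ ψ) by
    rw [star_mulVec, ← dotProduct_mulVec, mulVec_mulVec], re_star_dotProduct_self_eq_sum]
  exact Finset.sum_nonneg fun i _ => by positivity

/-- **Cauchy–Schwarz for a unit vector**: `(re ⟨ψ, R ψ⟩)² ≤ |⟨ψ, R ψ⟩|² ≤ ‖R ψ‖² = re ⟨ψ, Rᴴ R ψ⟩`.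
[folklore] -/
theorem sq_re_star_dotProduct_mulVec_le_re (R : Matrix n n ℂ) {ψ : n → ℂ}
    (hψ : star ψ ⬝ᵥ ψ = 1) :
    (star ψ ⬝ᵥ R *ᵥ ψ).re ^ 2 ≤ (star ψ ⬝ᵥ (Rᴴ * R) *ᵥ ψ).re := by
  have hCS : ‖star ψ ⬝ᵥ R *ᵥ ψ‖ ≤
      ‖(WithLp.toLp 2 ψ : EuclideanSpace ℂ n)‖ *
        ‖(WithLp.toLp 2 (R *ᵥ ψ) : EuclideanSpace ℂ n)‖ := by
    rw [star_dotProduct_eq_inner]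
    exact norm_inner_le_norm _ _
  have hψ1 : ‖(WithLp.toLp 2 ψ : EuclideanSpace ℂ n)‖ = 1 := by
    have h := norm_toLp_sq_eq_re ψ
    rw [hψ, Complex.one_re] at h
    have h0 : 0 ≤ ‖(WithLp.toLp 2 ψ : EuclideanSpace ℂ n)‖ := norm_nonneg _
    nlinarith [h, h0]
  rw [hψ1, one_mul] at hCS
  have hRR : (star ψ ⬝ᵥ (Rᴴ * R) *ᵥ ψ).re =
      ‖(WithLp.toLp 2 (R *ᵥ ψ) : EuclideanSpace ℂ n)‖ ^ 2 := by
    rw [norm_toLp_sq_eq_re, star_mulVec, ← dotProduct_mulVec, mulVec_mulVec]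
  calc (star ψ ⬝ᵥ R *ᵥ ψ).re ^ 2 ≤ ‖star ψ ⬝ᵥ R *ᵥ ψ‖ ^ 2 := by
        rw [sq_le_sq, abs_norm]
        exact Complex.abs_re_le_norm _
    _ ≤ ‖(WithLp.toLp 2 (R *ᵥ ψ) : EuclideanSpace ℂ n)‖ ^ 2 :=
        pow_le_pow_left₀ (norm_nonneg _) hCS 2
    _ = (star ψ ⬝ᵥ (Rᴴ * R) *ᵥ ψ).re := hRR.symm

/-- **The block-difference identity** (polarisation; `Sketch_ideator1g2.BlockDifferenceIdentity`
up to normalisation): the summed squared block DIFFERENCES equal `2 |s|` times the summed block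
intensities minus twice the intensity of the summed block,
`Σ_{x,x' ∈ s} (m x - m x')ᴴ (m x - m x') = 2 • |s| • Σ_x (m x)ᴴ m x - 2 • (Σ_x m x)ᴴ (Σ_x m x)`.
An identity of matrices, valid before taking any expectation. [folklore] -/
theorem sum_sum_conjTranspose_sub_mul_sub {ι : Type*} (s : Finset ι) (m : ι → Matrix n n ℂ) :
    ∑ x ∈ s, ∑ x' ∈ s, (m x - m x')ᴴ * (m x - m x') =
      2 • (s.card • ∑ x ∈ s, (m x)ᴴ * m x) - 2 • ((∑ x ∈ s, m x)ᴴ * ∑ x ∈ s, m x) := by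
  have hexp : ∀ x x', (m x - m x')ᴴ * (m x - m x') =
      ((m x)ᴴ * m x + (m x')ᴴ * m x') - ((m x)ᴴ * m x' + (m x')ᴴ * m x) := by
    intro x x'
    rw [conjTranspose_sub, Matrix.sub_mul, Matrix.mul_sub, Matrix.mul_sub]
    abel
  simp only [hexp, Finset.sum_sub_distrib, Finset.sum_add_distrib]
  have h1 : ∑ x ∈ s, ∑ _x' ∈ s, (m x)ᴴ * m x = s.card • ∑ x ∈ s, (m x)ᴴ * m x := by
    rw [Finset.smul_sum]
    exact Finset.sum_congr rfl fun x _ => Finset.sum_const _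
  have h2 : ∑ _x ∈ s, ∑ x' ∈ s, (m x')ᴴ * m x' = s.card • ∑ x ∈ s, (m x)ᴴ * m x :=
    Finset.sum_const _
  have h3 : ∑ x ∈ s, ∑ x' ∈ s, (m x)ᴴ * m x' = (∑ x ∈ s, m x)ᴴ * ∑ x ∈ s, m x := by
    rw [conjTranspose_sum, Finset.sum_mul]
    exact Finset.sum_congr rfl fun x _ => (Finset.mul_sum _ _ _).symm
  have h4 : ∑ x ∈ s, ∑ x' ∈ s, (m x')ᴴ * m x = (∑ x ∈ s, m x)ᴴ * ∑ x ∈ s, m x := by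
    rw [Finset.sum_comm, conjTranspose_sum, Finset.sum_mul]
    exact Finset.sum_congr rfl fun x' _ => (Finset.mul_sum _ _ _).symm
  rw [h1, h2, h3, h4]
  abel

end Domination

section TwoScale

variable {n : Type*} [Fintype n] [DecidableEq n]

/-- **Domination** (`Sketch_ideator1g2.Domination`, proved): for a positive semidefinite `X`, a
subspace `K` with orthogonal projection matrix `P` (the tree's idiom
`projMatrix (K.map (WithLp.linearEquiv 2 ℂ _).symm)`) and a unit vector `ψ ∈ K`,
`re ⟨ψ, X ψ⟩ ≤ re tr (P X) = dim K · ⟨X⟩_avg`. The only place the ground degeneracy enters the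
two-scale line: as a BUDGET. (`X = Bᴴ B` by the C⋆-order on matrices, then the core form.)
Bratteli–Robinson I §2.3. [folklore] -/
theorem domination (X : Matrix n n ℂ) (hX : X.PosSemidef) (K : Submodule ℂ (n → ℂ)) (ψ : n → ℂ)
    (hψK : ψ ∈ K) (hψ : star ψ ⬝ᵥ ψ = 1) :
    let P : Matrix n n ℂ := projMatrix (K.map
      ((WithLp.linearEquiv 2 ℂ (n → ℂ)).symm : (n → ℂ) →ₗ[ℂ] EuclideanSpace ℂ n))
    (star ψ ⬝ᵥ X *ᵥ ψ).re ≤ (P * X).trace.re := by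
  intro P
  open scoped MatrixOrder in
  obtain ⟨B, hB⟩ := CStarAlgebra.nonneg_iff_eq_star_mul_self.mp hX.nonneg
  rw [hB]
  exact re_star_dotProduct_conjTranspose_mul_self_mulVec_le (projMatrix_isHermitian _).eq
    (projMatrix_mul_self _) B (projMatrix_map_mulVec_of_mem K hψK) hψ

/-- **The two-scale domination inequality, working form** (sum form, with the positivity
facts a transfer needs). Data: a finite nonempty family of block matrices `m x`, their SUM
`S = Σ_x m x`, a subspace `K` with projection `P`, `d = re tr P`, a unit `ψ ∈ K`, a centre `t`;
GS-average functionals `A = Σ_x re tr (P (m x)ᴴ m x) / (|ι| d)` (block intensity),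
`Y = re tr (P Sᴴ S) / (|ι|² d)` (global intensity of the mean block `|ι|⁻¹ S`),
`V = Σ_x re tr (P ((m x)ᴴ m x - t)²) / (|ι| d)` (block variance about `t`). CLAIM: `0 < d`,
`0 ≤ V`, `Y ≤ A` (the SAG is non-negative: block-difference identity + positivity) and
`(t - √(d V) - d (A - Y)) |ι|² ≤ re ⟨ψ, Sᴴ S ψ⟩`. PROOF: (i) domination summed over the
block-difference identity: `|ι| A_ψ - Y_ψ ≤ |ι| (d A) - |ι|² (d Y)` (un-normalised); (ii)
`re ⟨ψ, (m x)ᴴ m x ψ⟩ = t + re ⟨ψ, R_x ψ⟩`, `R_x = (m x)ᴴ m x - t`, Cauchy–Schwarz and domination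
give `(re ⟨ψ, R_x ψ⟩)² ≤ re tr (P R_x²)`, hence (Cauchy–Schwarz in `x`) `A_ψ ≥ |ι| t - √(|ι| Σ)`;
(iii) subtract. Bratteli–Robinson I §2.3; Griffiths, Phys. Rev. 152 (1966) 240. [folklore] -/
theorem twoScaleDomination_sum (ι : Type*) [Fintype ι] [Nonempty ι] (m : ι → Matrix n n ℂ)
    (K : Submodule ℂ (n → ℂ)) (ψ : n → ℂ) (hψK : ψ ∈ K) (hψ : star ψ ⬝ᵥ ψ = 1) (t : ℝ) :
    let P : Matrix n n ℂ := projMatrix (K.map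
      ((WithLp.linearEquiv 2 ℂ (n → ℂ)).symm : (n → ℂ) →ₗ[ℂ] EuclideanSpace ℂ n))
    let d : ℝ := P.trace.re
    let S : Matrix n n ℂ := ∑ x, m x
    let A : ℝ := (∑ x, (P * ((m x)ᴴ * m x)).trace.re) / (Fintype.card ι * d)
    let Y : ℝ := (P * (Sᴴ * S)).trace.re / ((Fintype.card ι : ℝ) ^ 2 * d)
    let V : ℝ := (∑ x, (P * (((m x)ᴴ * m x - (t : ℂ) • 1) *
      ((m x)ᴴ * m x - (t : ℂ) • 1))).trace.re) / (Fintype.card ι * d)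
    0 < d ∧ 0 ≤ V ∧ Y ≤ A ∧
      (t - Real.sqrt (d * V) - d * (A - Y)) * (Fintype.card ι : ℝ) ^ 2 ≤
        (star ψ ⬝ᵥ (Sᴴ * S) *ᵥ ψ).re := by
  intro P d S A Y V
  -- the two real functionals `f = re ⟨ψ, · ψ⟩` and `g = re tr (P ·)`
  set f : Matrix n n ℂ →+ ℝ := AddMonoidHom.mk' (fun X => (star ψ ⬝ᵥ X *ᵥ ψ).re)
    (fun X X' => by simp only [add_mulVec, dotProduct_add, Complex.add_re]) with hf
  set g : Matrix n n ℂ →+ ℝ := AddMonoidHom.mk' (fun X => (P * X).trace.re)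
    (fun X X' => by simp only [Matrix.mul_add, trace_add, Complex.add_re]) with hg
  have hf_apply : ∀ X, f X = (star ψ ⬝ᵥ X *ᵥ ψ).re := fun X => rfl
  have hf_smul : ∀ (r : ℝ) (X : Matrix n n ℂ), f ((r : ℂ) • X) = r * f X := fun r X => by
    simp only [hf_apply, smul_mulVec, dotProduct_smul, smul_eq_mul, Complex.re_ofReal_mul]
  -- the projection and the unit vector
  have hPH : Pᴴ = P := (projMatrix_isHermitian _).eq
  have hPP : P * P = P := projMatrix_mul_self _
  have hPψ : P *ᵥ ψ = ψ := projMatrix_map_mulVec_of_mem K hψK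
  have dom : ∀ B : Matrix n n ℂ, f (Bᴴ * B) ≤ g (Bᴴ * B) := fun B =>
    re_star_dotProduct_conjTranspose_mul_self_mulVec_le hPH hPP B hPψ hψ
  have g_nonneg : ∀ B : Matrix n n ℂ, 0 ≤ g (Bᴴ * B) := fun B =>
    (re_star_dotProduct_conjTranspose_mul_self_mulVec_nonneg B ψ).trans (dom B)
  have hK : K ≠ ⊥ := by
    rintro rfl
    rw [Submodule.mem_bot] at hψK
    rw [hψK, dotProduct_zero] at hψ
    exact zero_ne_one hψ
  have hd : d = (Module.finrank ℂ K : ℝ) := by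
    show (projMatrix (K.map ((WithLp.linearEquiv 2 ℂ (n → ℂ)).symm :
      (n → ℂ) →ₗ[ℂ] EuclideanSpace ℂ n))).trace.re = _
    rw [trace_projMatrix_map_eq_finrank, Complex.natCast_re]
  have hdpos : 0 < d := by
    rw [hd, Nat.cast_pos]
    exact Module.finrank_pos_iff.mpr (Submodule.nontrivial_iff_ne_bot.mpr hK)
  have hNpos : (0 : ℝ) < Fintype.card ι := Nat.cast_pos.mpr Fintype.card_pos
  -- names
  set N : ℕ := Fintype.card ι with hN
  set R : ι → Matrix n n ℂ := fun x => (m x)ᴴ * m x - (t : ℂ) • 1 with hR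
  set aψ : ℝ := ∑ x, f ((m x)ᴴ * m x) with haψ
  set a : ℝ := ∑ x, g ((m x)ᴴ * m x) with ha
  set sψ : ℝ := f (Sᴴ * S) with hsψ
  set s : ℝ := g (Sᴴ * S) with hs
  set Q : ℝ := ∑ x, g (R x * R x) with hQ
  -- (i) domination on the block differences: `N aψ - sψ ≤ N a - s`, and the sag `s ≤ N a`
  have hi : (N : ℝ) * aψ - sψ ≤ N * a - s := by
    have h0 : f (∑ x, ∑ x', (m x - m x')ᴴ * (m x - m x')) ≤
        g (∑ x, ∑ x', (m x - m x')ᴴ * (m x - m x')) := by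
      simp only [map_sum]
      exact Finset.sum_le_sum fun x _ => Finset.sum_le_sum fun x' _ => dom _
    rw [sum_sum_conjTranspose_sub_mul_sub, Finset.card_univ] at h0
    simp only [map_sub, map_nsmul, map_sum] at h0
    rw [← haψ, ← ha] at h0
    simp only [nsmul_eq_mul, Nat.cast_ofNat] at h0
    linarith
  have hsag : s ≤ (N : ℝ) * a := by
    have h0 : 0 ≤ g (∑ x, ∑ x', (m x - m x')ᴴ * (m x - m x')) := by
      simp only [map_sum]
      exact Finset.sum_nonneg fun x _ => Finset.sum_nonneg fun x' _ => g_nonneg _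
    rw [sum_sum_conjTranspose_sub_mul_sub, Finset.card_univ] at h0
    simp only [map_sub, map_nsmul, map_sum] at h0
    rw [← ha] at h0
    simp only [nsmul_eq_mul, Nat.cast_ofNat] at h0
    linarith
  -- (ii) rigidity: `N t - √(N Q) ≤ aψ`, via `re ⟨ψ, (m x)ᴴ m x ψ⟩ = t + re ⟨ψ, R x ψ⟩`
  have hRH : ∀ x, (R x)ᴴ = R x := fun x => by
    simp only [hR, conjTranspose_sub, conjTranspose_mul, conjTranspose_conjTranspose,
      conjTranspose_smul, conjTranspose_one, Complex.star_def, Complex.conj_ofReal]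
  have hft : f ((t : ℂ) • (1 : Matrix n n ℂ)) = t := by
    rw [hf_smul, hf_apply, one_mulVec, hψ, Complex.one_re, mul_one]
  have hsplit : ∀ x, f ((m x)ᴴ * m x) = t + f (R x) := fun x => by
    have : (m x)ᴴ * m x = R x + (t : ℂ) • 1 := by simp only [hR, sub_add_cancel]
    rw [this, map_add, hft, add_comm]
  have hsq : ∀ x, (f (R x)) ^ 2 ≤ g (R x * R x) := fun x => by
    have h1 := sq_re_star_dotProduct_mulVec_le_re (R x) hψ
    rw [hRH x] at h1
    have h2 := dom (R x)
    rw [hRH x] at h2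
    exact h1.trans h2
  have hQnn : 0 ≤ Q := Finset.sum_nonneg fun x _ => (sq_nonneg _).trans (hsq x)
  have hN0 : (N : ℝ) ≠ 0 := hNpos.ne'
  have hii : (N : ℝ) * t - N * Real.sqrt (Q / N) ≤ aψ := by
    -- `aψ = N t + Σ f (R x)` and `|Σ f (R x)| ≤ Σ |f (R x)| ≤ √(N Q) = N √(Q / N)`
    have hsum : aψ = N * t + ∑ x, f (R x) := by
      rw [haψ, Finset.sum_congr rfl fun x _ => hsplit x, Finset.sum_add_distrib, Finset.sum_const,
        Finset.card_univ, nsmul_eq_mul]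
    have hCS : (∑ x, |f (R x)|) ^ 2 ≤ N * Q := by
      have h := Finset.sum_mul_sq_le_sq_mul_sq Finset.univ (fun _ => (1 : ℝ)) fun x => |f (R x)|
      simp only [one_mul, one_pow, Finset.sum_const, Finset.card_univ, nsmul_eq_mul, mul_one,
        sq_abs] at h
      refine h.trans ?_
      rw [hQ]
      exact mul_le_mul_of_nonneg_left (Finset.sum_le_sum fun x _ => hsq x) (Nat.cast_nonneg _)
    have hroot : Real.sqrt (N * Q) = N * Real.sqrt (Q / N) := by
      have e : (N : ℝ) * Q = (N : ℝ) ^ 2 * (Q / N) := by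
        field_simp
      rw [e, Real.sqrt_mul (sq_nonneg _), Real.sqrt_sq hNpos.le]
    have habs : |∑ x, f (R x)| ≤ N * Real.sqrt (Q / N) :=
      (Finset.abs_sum_le_sum_abs _ _).trans
        ((le_abs_self _).trans (hroot ▸ Real.abs_le_sqrt hCS))
    have := neg_abs_le (∑ x, f (R x))
    linarith
  -- (iii) assemble
  have hA : A = a / (N * d) := by
    show (∑ x, (P * ((m x)ᴴ * m x)).trace.re) / (Fintype.card ι * d) = _
    rfl
  have hY : Y = s / ((N : ℝ) ^ 2 * d) := rfl
  have hV : V = Q / (N * d) := by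
    show (∑ x, (P * (((m x)ᴴ * m x - (t : ℂ) • 1) *
      ((m x)ᴴ * m x - (t : ℂ) • 1))).trace.re) / (Fintype.card ι * d) = _
    rfl
  have hgoal : (star ψ ⬝ᵥ (Sᴴ * S) *ᵥ ψ).re = sψ := rfl
  have hNd : (0 : ℝ) < N * d := mul_pos hNpos hdpos
  have hN2d : (0 : ℝ) < (N : ℝ) ^ 2 * d := mul_pos (pow_pos hNpos 2) hdpos
  refine ⟨hdpos, ?_, ?_, ?_⟩
  · rw [hV]
    exact div_nonneg hQnn hNd.le
  · rw [hY, hA, div_le_div_iff₀ hN2d hNd]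
    have := mul_le_mul_of_nonneg_right hsag hNd.le
    exact this.trans (le_of_eq (by ring))
  rw [hgoal, hA, hY, hV]
  have hdV : d * (Q / (N * d)) = Q / N := by field_simp
  have hdAY : d * (a / (N * d) - s / ((N : ℝ) ^ 2 * d)) = a / N - s / N ^ 2 := by
    field_simp
  rw [hdV, hdAY]
  -- from (i): `sψ ≥ N aψ - N a + s`; from (ii): `N aψ ≥ N² t - N² √(Q / N)`
  have key : (N : ℝ) ^ 2 * (t - Real.sqrt (Q / N)) - N * a + s ≤ sψ := by
    have h3 := mul_le_mul_of_nonneg_left hii hNpos.le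
    nlinarith [hi, h3]
  have e2 : (t - Real.sqrt (Q / N) - (a / N - s / N ^ 2)) * (N : ℝ) ^ 2 =
      (N : ℝ) ^ 2 * (t - Real.sqrt (Q / N)) - N * a + s := by
    field_simp
    ring
  rw [e2]
  exact key

/-- **THE TWO-SCALE DOMINATION INEQUALITY (★)** — first lemma of card `two-scale-domination`
(`Sketch_ideator1g2.TwoScaleDomination`, proved in its binder shape). Data: a finite nonempty
family of block matrices `m x`, their MEAN `M = |ι|⁻¹ Σ_x m x`, a subspace `K` with projection
`P`, `d = re tr P`, a unit `ψ ∈ K`, a centre `t`. With the GS-average functionals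
`A = Σ_x re tr (P (m x)ᴴ m x) / (|ι| d)` (block intensity), `Y = re tr (P Mᴴ M) / d` (global
intensity) and `V = Σ_x re tr (P ((m x)ᴴ m x - t)²) / (|ι| d)` (block variance about `t`):
`t - √(d V) - d (A - Y) ≤ re ⟨ψ, Mᴴ M ψ⟩` — EVERY vector of `K` carries the average global
intensity up to a block-RIGIDITY error and a SAG error; the degeneracy `d` enters only as a budget,
never through the structure of `K` (no irreducibility, no genericity). From
`twoScaleDomination_sum` by `Mᴴ M = |ι|⁻² Sᴴ S`.
Bratteli–Robinson I §2.3; Griffiths, Phys. Rev. 152 (1966) 240. [folklore] -/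
theorem twoScaleDomination {n : Type*} [Fintype n] [DecidableEq n] (ι : Type*) [Fintype ι] [Nonempty ι] (m : ι → Matrix n n ℂ) (K : Submodule ℂ (n → ℂ)) (ψ : n → ℂ) (hψK : ψ ∈ K) (hψ : star ψ ⬝ᵥ ψ = 1) (t : ℝ) : let P : Matrix n n ℂ := projMatrix (K.map ((WithLp.linearEquiv 2 ℂ (n → ℂ)).symm : (n → ℂ) →ₗ[ℂ] EuclideanSpace ℂ n)); let d : ℝ := P.trace.re; let M : Matrix n n ℂ := ((Fintype.card ι : ℂ))⁻¹ • ∑ x, m x; let A : ℝ := (∑ x, (P * ((m x)ᴴ * m x)).trace.re) / (Fintype.card ι * d); let Y : ℝ := (P * (Mᴴ * M)).trace.re / d; let V : ℝ := (∑ x, (P * (((m x)ᴴ * m x - (t : ℂ) • 1) * ((m x)ᴴ * m x - (t : ℂ) • 1))).trace.re) / (Fintype.card ι * d); t - Real.sqrt (d * V) - d * (A - Y) ≤ (star ψ ⬝ᵥ (Mᴴ * M) *ᵥ ψ).re := by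
  intro P d M A Y V
  obtain ⟨hd0, -, -, hmain⟩ := twoScaleDomination_sum ι m K ψ hψK hψ t
  change (t - Real.sqrt (d * V) - d * (A - (P * ((∑ x, m x)ᴴ * ∑ x, m x)).trace.re /
      ((Fintype.card ι : ℝ) ^ 2 * d))) * (Fintype.card ι : ℝ) ^ 2 ≤
    (star ψ ⬝ᵥ ((∑ x, m x)ᴴ * ∑ x, m x) *ᵥ ψ).re at hmain
  have hNpos : (0 : ℝ) < Fintype.card ι := Nat.cast_pos.mpr Fintype.card_pos
  set N : ℕ := Fintype.card ι with hN
  set S : Matrix n n ℂ := ∑ x, m x with hS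
  have hNinv : ((N : ℂ))⁻¹ = (((N : ℝ)⁻¹ : ℝ) : ℂ) := by push_cast; rfl
  have hMM : Mᴴ * M = ((((N : ℝ)⁻¹) ^ 2 : ℝ) : ℂ) • (Sᴴ * S) := by
    show (((N : ℂ))⁻¹ • S)ᴴ * (((N : ℂ))⁻¹ • S) = _
    rw [hNinv, conjTranspose_smul, Complex.star_def, Complex.conj_ofReal, Matrix.smul_mul,
      Matrix.mul_smul, smul_smul, ← Complex.ofReal_mul, sq]
  have hYv : Y = (N : ℝ)⁻¹ ^ 2 * (P * (Sᴴ * S)).trace.re / d := by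
    show (P * (Mᴴ * M)).trace.re / d = _
    rw [hMM, Matrix.mul_smul, trace_smul, smul_eq_mul, Complex.re_ofReal_mul]
  rw [hMM, smul_mulVec, dotProduct_smul, smul_eq_mul, Complex.re_ofReal_mul, hYv]
  have hN0 : (N : ℝ) ≠ 0 := hNpos.ne'
  have e1 : (N : ℝ)⁻¹ ^ 2 * (P * (Sᴴ * S)).trace.re / d =
      (P * (Sᴴ * S)).trace.re / ((N : ℝ) ^ 2 * d) := by
    field_simp
  have e2 : (N : ℝ)⁻¹ ^ 2 * (star ψ ⬝ᵥ (Sᴴ * S) *ᵥ ψ).re =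
      (star ψ ⬝ᵥ (Sᴴ * S) *ᵥ ψ).re / (N : ℝ) ^ 2 := by
    field_simp
  rw [e1, e2, le_div_iff₀ (pow_pos hNpos 2)]
  exact hmain

/-- **The budgeted form of (★)** consumed by every transfer: with the block variance centred at the
block intensity (`t = A`), if the global intensity of the average is `≥ c`, the degeneracy is
`≤ D`, the block variance is `≤ ε₁`, the sag is `≤ ε₂` and `√(D ε₁) + D ε₂ ≤ c / 2`, then EVERY
unit vector of `K` has `(c / 2) |ι|² ≤ re ⟨ψ, Sᴴ S ψ⟩` (`S = Σ_x m x`; i.e. `c / 2 ≤ re ⟨ψ, Mᴴ M ψ⟩`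
for the mean block `M = |ι|⁻¹ S`): `A - √(d V) - d (A - Y) ≥ Y - √(D ε₁) - D ε₂ ≥ c - c / 2`
(using `Y ≤ A`, `0 ≤ V`, `0 < d ≤ D` from `twoScaleDomination_sum`). [folklore] -/
theorem mul_sq_card_le_re_of_twoScale (ι : Type*) [Fintype ι] [Nonempty ι]
    (m : ι → Matrix n n ℂ) (K : Submodule ℂ (n → ℂ)) (ψ : n → ℂ) (hψK : ψ ∈ K)
    (hψ : star ψ ⬝ᵥ ψ = 1) (c D ε₁ ε₂ : ℝ) (hε : Real.sqrt (D * ε₁) + D * ε₂ ≤ c / 2) :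
    let P : Matrix n n ℂ := projMatrix (K.map
      ((WithLp.linearEquiv 2 ℂ (n → ℂ)).symm : (n → ℂ) →ₗ[ℂ] EuclideanSpace ℂ n))
    let d : ℝ := P.trace.re
    let S : Matrix n n ℂ := ∑ x, m x
    let A : ℝ := (∑ x, (P * ((m x)ᴴ * m x)).trace.re) / (Fintype.card ι * d)
    let Y : ℝ := (P * (Sᴴ * S)).trace.re / ((Fintype.card ι : ℝ) ^ 2 * d)
    let V : ℝ := (∑ x, (P * (((m x)ᴴ * m x - (A : ℂ) • 1) *
      ((m x)ᴴ * m x - (A : ℂ) • 1))).trace.re) / (Fintype.card ι * d)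
    c ≤ Y → d ≤ D → V ≤ ε₁ → A - Y ≤ ε₂ →
      c / 2 * (Fintype.card ι : ℝ) ^ 2 ≤ (star ψ ⬝ᵥ (Sᴴ * S) *ᵥ ψ).re := by
  intro P d S A Y V hcY hdD hV₁ hAY
  obtain ⟨hd0, hV0, hYA, hmain⟩ := twoScaleDomination_sum ι m K ψ hψK hψ A
  change 0 < d at hd0
  change 0 ≤ V at hV0
  change Y ≤ A at hYA
  change (A - Real.sqrt (d * V) - d * (A - Y)) * (Fintype.card ι : ℝ) ^ 2 ≤
    (star ψ ⬝ᵥ (Sᴴ * S) *ᵥ ψ).re at hmain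
  have hD0 : 0 ≤ D := hd0.le.trans hdD
  have h1 : Real.sqrt (d * V) ≤ Real.sqrt (D * ε₁) :=
    Real.sqrt_le_sqrt (mul_le_mul hdD hV₁ hV0 hD0)
  have h2 : d * (A - Y) ≤ D * ε₂ :=
    (mul_le_mul_of_nonneg_right hdD (sub_nonneg.mpr hYA)).trans
      (mul_le_mul_of_nonneg_left hAY hD0)
  have h3 : c / 2 ≤ A - Real.sqrt (d * V) - d * (A - Y) := by linarith
  exact (mul_le_mul_of_nonneg_right h3 (by positivity)).trans hmain

end TwoScale

end Summit.HubbardSuperconductivity.HubbardSuperconductivity.Theorems
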